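import Mathlib
import Summits.KontsevichZagierPeriods.Zeta5Search.BigPrimeDual2
import HarnessLib

/-!
# ζ(5) search — (W∞) ON THE FULL (WV)-WINDOW: every prime in `(b₀ − b₍₂₎ − b₍₃₎, d(b)+1]`, `p ≥ 7`, divides `W(b)`

Cell `pub-zeta5` (HONEST FRAMING: systematic search; no irrationality claim unless certified), typer seat
generation 7.  OUR theorem (Summit side; coefficient arithmetic only), completing the chain
`BigPrimeDivisibility` (`p > b₀`) → `BigPrimeBelowB0` (`p > b₀ − 2b₍₂₎`) → this file (`p > b₀ − b₍₂₎ − b₍₃₎`):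

**THEOREM (`one_le_padicValRat_coeffW_of_slots`).**  Let `b ∈ ℤ⁸` lie in the Brown–Zudilin polytope, let
`j₁, j₂, j₃` be slots with `j₂ ≠ j₁`, `b_{j₂} ≤ b_{j₃} ≤ b_j` for all `j ∉ {j₁, j₂}` (optimally the three smallest
parameters `b₍₁₎ ≤ b₍₂₎ ≤ b₍₃₎`).  Then every prime `p` with `max(7, b₀ + 1 − b_{j₂} − b_{j₃}) ≤ p ≤ d(b)+1` satisfies
`v_p(W(b)) ≥ 1`; and (`…_coeffU_of_slots`, `p ≥ 5`) `v_p(U(b)) ≥ 1` when `2p ≤ d(b)+1`.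
This is EXACTLY the range in which gen-2's OBSERVED law (WV) predicts `v_p(W) ≥ 1` with all pair floors `≤ 1`
(the pairs avoiding the minimal slot have blocks `b₀ − b_i − b_k ≤ b₀ − b₍₂₎ − b₍₃₎ < p`); below it (WV) predicts only
`≥ 0` and divisibility indeed fails generically (prototype: 8/1465).  Prototype for this window with `p ≤ b₀ − 2b₍₂₎`:
665/665 (`W`), 99/99 (`U`).  Record ray `(41;17,…,11)·m`: all primes in `(16m, 25m+1]` (m = 1: 17, 19, 23 — exact).
PROOF: `BigPrimeSupport2` + `BigPrimeDual2`; here the assembly `U2·W = Z2`, `Z2 ≡ U2·Σ_{x∈𝔽_p}[X^5]M2(X+x)`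
(`[X^3]` for `U`), which vanishes for `deg M2 < 6p − 1 ⟺ p ≤ d+1` (`< 4p − 1 ⟺ 2p ≤ d+1`); `p ≥ 7` because the
Hasse index is `5`.
-/

noncomputable section

open Finset Polynomial

namespace Summit.KontsevichZagierPeriods.Zeta5Search.BigPrime

open Summit.KontsevichZagierPeriods.Zeta5Search.DualSeries (InBox numPoly)
open Summit.KontsevichZagierPeriods.Zeta5Search.WedgeDictionary (IsPFData coeffW coeffU coeffW_eq coeffU_eq
  exists_isPFData dOf)

/-! ### Assembly at level 2 -/

section Assembly2

/-- Common denominator over `S'` at level 2. -/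
def U2all (n : ℕ) (β : ℕ → ℕ) (j₂ j₃ : ℕ) : ℤ := ∏ q ∈ block n (β j₃), e20 n β j₂ j₃ q ^ 6

/-- Cleared numerator over `S'` at level 2. -/
def Z2sum (n : ℕ) (β : ℕ → ℕ) (j₁ j₂ j₃ i : ℕ) : ℤ :=
  ∑ q ∈ block n (β j₃), z2 n β j₁ j₂ j₃ q i * ∏ s ∈ (block n (β j₃)).erase q, e20 n β j₂ j₃ s ^ 6

/-- No prime in the level-2 window divides `U2`. -/
theorem not_dvd_U2all {p : ℕ} (hp : p.Prime) {n : ℕ} {β : ℕ → ℕ} {j₂ j₃ : ℕ} (hT : n + 1 ≤ p + β j₂ + β j₃)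
    (h23 : β j₂ ≤ β j₃) : ¬ (p : ℤ) ∣ U2all n β j₂ j₃ := by
  have hpZ : Prime (p : ℤ) := Nat.prime_iff_prime_int.1 hp
  intro h
  obtain ⟨q, hq, hdvd⟩ := (hpZ.dvd_finsetProd_iff _).1 h
  exact not_dvd_e20 hp hT h23 hq (hpZ.dvd_of_dvd_pow hdvd)

/-- `U2 · Σ_{q ≤ n} c_{o,q} = Z2_{5−o}` for `1 ≤ o < 6` (the data vanish off `S'` in these orders). -/
theorem U2all_mul_sum_eq (b : ℕ → ℤ) (hb : InBox b) (hhalf : ∀ j ∈ range 7, 2 * b (j + 1) ≤ b 0 + 1)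
    {c : ℕ → ℕ → ℚ} (hc : IsPFData b c) {j₁ j₂ j₃ : ℕ} (hj₁ : j₁ ∈ range 7) (hj₂ : j₂ ∈ (range 7).erase j₁)
    (h23 : (b (j₂ + 1)).toNat ≤ (b (j₃ + 1)).toNat)
    (hmin : ∀ j ∈ ((range 7).erase j₁).erase j₂, (b (j₃ + 1)).toNat ≤ (b (j + 1)).toNat)
    {o : ℕ} (ho1 : 1 ≤ o) (ho : o < 6) :
    (U2all (b 0).toNat (fun j => (b (j + 1)).toNat) j₂ j₃ : ℚ) * ∑ q ∈ range ((b 0).toNat + 1), c o q =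
      (Z2sum (b 0).toNat (fun j => (b (j + 1)).toNat) j₁ j₂ j₃ (5 - o) : ℚ) := by
  set n := (b 0).toNat with hn
  set β : ℕ → ℕ := fun j => (b (j + 1)).toNat with hβ
  have hmin2 : ∀ j ∈ range 7, j ≠ j₁ → β j₂ ≤ β j := by
    intro j hj hne
    by_cases hj2 : j = j₂
    · rw [hj2]
    · exact h23.trans (hmin j (mem_erase.2 ⟨hj2, mem_erase.2 ⟨hne, hj⟩⟩))
  have hsum : ∑ q ∈ range (n + 1), c o q = ∑ q ∈ block n (β j₃), c o q := by
    symm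
    refine sum_subset (block_subset n (β j₃)) fun q hq hqS => ?_
    by_cases hq2 : q ∈ block n (β j₂)
    · exact pf_eq_zero_of_mem_rim b hb hhalf hc hj₁ hj₂ h23 hmin (by rw [rim, mem_sdiff]; exact ⟨hq2, hqS⟩) ho1 ho
    · exact pf_eq_zero_of_not_mem b hb hhalf hc hj₁ hmin2 (Nat.lt_succ_iff.1 (mem_range.1 hq)) hq2 ho
  rw [hsum, mul_sum, Z2sum]
  push_cast
  refine sum_congr rfl fun q hq => ?_
  rw [U2all, ← mul_prod_erase _ _ hq]
  push_cast
  rw [← pf_coeff_eq2 b hb hhalf hc hj₁ hj₂ h23 hmin hq ho]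
  ring

/-- `Z2_i ≡ U2 · Σ_x [X^{i+2}] M2(X+x) (mod p)` for `i < 4`. -/
theorem Z2sum_cast {p : ℕ} [hp : Fact p.Prime] (hp5 : 5 ≤ p) {n : ℕ} {β : ℕ → ℕ} {j₁ j₂ j₃ : ℕ}
    (hj₁ : j₁ ∈ range 7) (hj₂ : j₂ ∈ (range 7).erase j₁) (hS : n + 1 ≤ p + 2 * β j₃)
    (hT : n + 1 ≤ p + β j₂ + β j₃) (h23 : β j₂ ≤ β j₃) (h3 : 2 * β j₃ ≤ n)
    (hmin : ∀ j ∈ ((range 7).erase j₁).erase j₂, β j₃ ≤ β j) {i : ℕ} (hi : i < 4) :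
    ((Z2sum n β j₁ j₂ j₃ i : ℤ) : ZMod p) =
      ((U2all n β j₂ j₃ : ℤ) : ZMod p) * ∑ x : ZMod p, (taylor x (M2 p n β j₁ j₂ j₃)).coeff (i + 2) := by
  rw [sum_univ_taylor_M2_coeff hj₁ hj₂ hS hmin (by omega), Z2sum, mul_sum]
  push_cast
  refine sum_congr rfl fun q hq => ?_
  rw [z2_cast hp5 hj₁ hj₂ hS hT h23 h3 hmin hq hi, U2all, ← mul_prod_erase _ _ hq]
  push_cast
  ring

open Summit.KontsevichZagierPeriods.Zeta5Search.WedgeDictionary (coeffW coeffU coeffW_eq coeffU_eq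
  exists_isPFData dOf)

/-- (W∞) at level 2, cleared form. -/
theorem exists_clear_coeffW_of_slots (b : ℕ → ℤ) (p j₁ j₂ j₃ : ℕ) (hb : InBox b)
    (h2 : ∀ i ∈ range 7, 2 * b (i + 1) ≤ b 0) (h3 : ∑ i ∈ range 7, b (i + 1) ≤ 3 * b 0)
    (hj₁ : j₁ ∈ range 7) (hj₂ : j₂ ∈ range 7) (hj₃ : j₃ ∈ range 7) (h12 : j₂ ≠ j₁)
    (hle : b (j₂ + 1) ≤ b (j₃ + 1)) (hmin : ∀ j ∈ range 7, j ≠ j₁ → j ≠ j₂ → b (j₃ + 1) ≤ b (j + 1))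
    (hprime : p.Prime) (hp7 : 7 ≤ p) (hpT : b 0 + 1 ≤ (p : ℤ) + b (j₂ + 1) + b (j₃ + 1))
    (hpd : (p : ℤ) ≤ dOf b + 1) :
    ∃ U Z : ℤ, ¬ (p : ℤ) ∣ U ∧ (p : ℤ) ∣ Z ∧ (U : ℚ) * coeffW b = Z := by
  haveI : Fact p.Prime := ⟨hprime⟩
  obtain ⟨e0, hS, hβ, hS3⟩ := polytope_data b hb h2 h3
  have hj₂' : j₂ ∈ (range 7).erase j₁ := mem_erase.2 ⟨h12, hj₂⟩
  have h02 : 0 ≤ b (j₂ + 1) := (hb.2 j₂ hj₂).1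
  have h03 : 0 ≤ b (j₃ + 1) := (hb.2 j₃ hj₃).1
  have e2 : (b (j₂ + 1) : ℤ) = ((b (j₂ + 1)).toNat : ℤ) := (Int.toNat_of_nonneg h02).symm
  have e3 : (b (j₃ + 1) : ℤ) = ((b (j₃ + 1)).toNat : ℤ) := (Int.toNat_of_nonneg h03).symm
  have h23 : (b (j₂ + 1)).toNat ≤ (b (j₃ + 1)).toNat := Int.toNat_le_toNat hle
  have hmin' : ∀ j ∈ ((range 7).erase j₁).erase j₂, (b (j₃ + 1)).toNat ≤ (b (j + 1)).toNat := by
    intro j hj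
    have hj' := mem_erase.1 hj; have hj'' := mem_erase.1 hj'.2
    exact Int.toNat_le_toNat (hmin j hj''.2 hj''.1 hj'.1)
  have hT' : (b 0).toNat + 1 ≤ p + (b (j₂ + 1)).toNat + (b (j₃ + 1)).toNat := by omega
  have hS' : (b 0).toNat + 1 ≤ p + 2 * (b (j₃ + 1)).toNat := by omega
  have h3' : 2 * (b (j₃ + 1)).toNat ≤ (b 0).toNat := hβ j₃ hj₃
  have hpd' : p + ∑ j ∈ range 7, (b (j + 1)).toNat ≤ 3 * (b 0).toNat + 1 := by
    have := hpd; rw [dOf, hS, e0] at this; omega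
  have hhalf : ∀ j ∈ range 7, 2 * b (j + 1) ≤ b 0 + 1 := fun j hj => by have := h2 j hj; omega
  obtain ⟨c, hc⟩ := exists_isPFData b hb (by omega)
  refine ⟨_, _, not_dvd_U2all hprime hT' h23, ?_,
    by rw [coeffW_eq hc]; exact U2all_mul_sum_eq b hb hhalf hc hj₁ hj₂' h23 hmin' (by norm_num) (by norm_num : 2 < 6)⟩
  rw [← ZMod.intCast_zmod_eq_zero_iff_dvd, Z2sum_cast (by omega) hj₁ hj₂' hS' hT' h23 h3' hmin' (by norm_num : 3 < 4),
    sum_taylor_coeff_eq_zero (M2 p (b 0).toNat (fun j => (b (j + 1)).toNat) j₁ j₂ j₃) 5 (by omega), mul_zero]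
  have := natDegree_M2_le (p := p) hj₁ hj₂' hS' hT' h23 hmin' hβ h3'
  beta_reduce at this
  omega

/-- (U∞) at level 2, cleared form (`2p ≤ d+1`). -/
theorem exists_clear_coeffU_of_slots (b : ℕ → ℤ) (p j₁ j₂ j₃ : ℕ) (hb : InBox b)
    (h2 : ∀ i ∈ range 7, 2 * b (i + 1) ≤ b 0) (h3 : ∑ i ∈ range 7, b (i + 1) ≤ 3 * b 0)
    (hj₁ : j₁ ∈ range 7) (hj₂ : j₂ ∈ range 7) (hj₃ : j₃ ∈ range 7) (h12 : j₂ ≠ j₁)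
    (hle : b (j₂ + 1) ≤ b (j₃ + 1)) (hmin : ∀ j ∈ range 7, j ≠ j₁ → j ≠ j₂ → b (j₃ + 1) ≤ b (j + 1))
    (hprime : p.Prime) (hp5 : 5 ≤ p) (hpT : b 0 + 1 ≤ (p : ℤ) + b (j₂ + 1) + b (j₃ + 1))
    (hpd : 2 * (p : ℤ) ≤ dOf b + 1) :
    ∃ U Z : ℤ, ¬ (p : ℤ) ∣ U ∧ (p : ℤ) ∣ Z ∧ (U : ℚ) * coeffU b = Z := by
  haveI : Fact p.Prime := ⟨hprime⟩
  obtain ⟨e0, hS, hβ, hS3⟩ := polytope_data b hb h2 h3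
  have hj₂' : j₂ ∈ (range 7).erase j₁ := mem_erase.2 ⟨h12, hj₂⟩
  have h02 : 0 ≤ b (j₂ + 1) := (hb.2 j₂ hj₂).1
  have h03 : 0 ≤ b (j₃ + 1) := (hb.2 j₃ hj₃).1
  have e2 : (b (j₂ + 1) : ℤ) = ((b (j₂ + 1)).toNat : ℤ) := (Int.toNat_of_nonneg h02).symm
  have e3 : (b (j₃ + 1) : ℤ) = ((b (j₃ + 1)).toNat : ℤ) := (Int.toNat_of_nonneg h03).symm
  have h23 : (b (j₂ + 1)).toNat ≤ (b (j₃ + 1)).toNat := Int.toNat_le_toNat hle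
  have hmin' : ∀ j ∈ ((range 7).erase j₁).erase j₂, (b (j₃ + 1)).toNat ≤ (b (j + 1)).toNat := by
    intro j hj
    have hj' := mem_erase.1 hj; have hj'' := mem_erase.1 hj'.2
    exact Int.toNat_le_toNat (hmin j hj''.2 hj''.1 hj'.1)
  have hT' : (b 0).toNat + 1 ≤ p + (b (j₂ + 1)).toNat + (b (j₃ + 1)).toNat := by omega
  have hS' : (b 0).toNat + 1 ≤ p + 2 * (b (j₃ + 1)).toNat := by omega
  have h3' : 2 * (b (j₃ + 1)).toNat ≤ (b 0).toNat := hβ j₃ hj₃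
  have hpd' : 2 * p + ∑ j ∈ range 7, (b (j + 1)).toNat ≤ 3 * (b 0).toNat + 1 := by
    have := hpd; rw [dOf, hS, e0] at this; omega
  have hhalf : ∀ j ∈ range 7, 2 * b (j + 1) ≤ b 0 + 1 := fun j hj => by have := h2 j hj; omega
  obtain ⟨c, hc⟩ := exists_isPFData b hb (by omega)
  refine ⟨_, _, not_dvd_U2all hprime hT' h23, ?_,
    by rw [coeffU_eq hc]; exact U2all_mul_sum_eq b hb hhalf hc hj₁ hj₂' h23 hmin' (by norm_num) (by norm_num : 4 < 6)⟩
  rw [← ZMod.intCast_zmod_eq_zero_iff_dvd, Z2sum_cast hp5 hj₁ hj₂' hS' hT' h23 h3' hmin' (by norm_num : 1 < 4),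
    sum_taylor_coeff_eq_zero (M2 p (b 0).toNat (fun j => (b (j + 1)).toNat) j₁ j₂ j₃) 3 (by omega), mul_zero]
  have := natDegree_M2_le (p := p) hj₁ hj₂' hS' hT' h23 hmin' hβ h3'
  beta_reduce at this
  omega

/-- **(W∞) ON THE FULL (WV)-WINDOW.**  Let `b` lie in the Brown–Zudilin polytope; drop a slot `j₁`, let `j₂ ≠ j₁`
be a slot with `b_{j₂} ≤ b_{j₃}` and `j₃` a slot with `b_{j₃} ≤ b_j` for every other slot `j ∉ {j₁, j₂}` (optimal choice:
`b_{j₁} ≤ b_{j₂} ≤ b_{j₃}` the three smallest parameters).  Then every prime `p` with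
`max(7, b₀ + 1 − b_{j₂} − b_{j₃}) ≤ p ≤ d(b) + 1` divides the ζ(3)-coefficient: `v_p(W(b)) ≥ 1`.
(Record ray `(41;17,…,11)·m`: every prime in `(16m, 25m+1]`, `p ≥ 7`.) -/
theorem one_le_padicValRat_coeffW_of_slots (b : ℕ → ℤ) (p j₁ j₂ j₃ : ℕ) (hb : InBox b)
    (h2 : ∀ i ∈ range 7, 2 * b (i + 1) ≤ b 0) (h3 : ∑ i ∈ range 7, b (i + 1) ≤ 3 * b 0)
    (hj₁ : j₁ ∈ range 7) (hj₂ : j₂ ∈ range 7) (hj₃ : j₃ ∈ range 7) (h12 : j₂ ≠ j₁)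
    (hle : b (j₂ + 1) ≤ b (j₃ + 1)) (hmin : ∀ j ∈ range 7, j ≠ j₁ → j ≠ j₂ → b (j₃ + 1) ≤ b (j + 1))
    (hprime : p.Prime) (hp7 : 7 ≤ p) (hpT : b 0 + 1 ≤ (p : ℤ) + b (j₂ + 1) + b (j₃ + 1))
    (hpd : (p : ℤ) ≤ dOf b + 1) (hW : coeffW b ≠ 0) : 1 ≤ padicValRat p (coeffW b) := by
  haveI : Fact p.Prime := ⟨hprime⟩
  obtain ⟨U, Z, hU, hZ, hUW⟩ :=
    exists_clear_coeffW_of_slots b p j₁ j₂ j₃ hb h2 h3 hj₁ hj₂ hj₃ h12 hle hmin hprime hp7 hpT hpd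
  exact one_le_padicValRat_of_eq hUW hU hZ hW

/-- **(U∞) ON THE FULL WINDOW**: same slots, `p ≥ 5`, `b₀+1 ≤ p + b_{j₂} + b_{j₃}`, `2p ≤ d(b)+1` ⟹ `v_p(U(b)) ≥ 1`. -/
theorem one_le_padicValRat_coeffU_of_slots (b : ℕ → ℤ) (p j₁ j₂ j₃ : ℕ) (hb : InBox b)
    (h2 : ∀ i ∈ range 7, 2 * b (i + 1) ≤ b 0) (h3 : ∑ i ∈ range 7, b (i + 1) ≤ 3 * b 0)
    (hj₁ : j₁ ∈ range 7) (hj₂ : j₂ ∈ range 7) (hj₃ : j₃ ∈ range 7) (h12 : j₂ ≠ j₁)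
    (hle : b (j₂ + 1) ≤ b (j₃ + 1)) (hmin : ∀ j ∈ range 7, j ≠ j₁ → j ≠ j₂ → b (j₃ + 1) ≤ b (j + 1))
    (hprime : p.Prime) (hp5 : 5 ≤ p) (hpT : b 0 + 1 ≤ (p : ℤ) + b (j₂ + 1) + b (j₃ + 1))
    (hpd : 2 * (p : ℤ) ≤ dOf b + 1) (hU : coeffU b ≠ 0) : 1 ≤ padicValRat p (coeffU b) := by
  haveI : Fact p.Prime := ⟨hprime⟩
  obtain ⟨U, Z, hU', hZ, hUU⟩ :=
    exists_clear_coeffU_of_slots b p j₁ j₂ j₃ hb h2 h3 hj₁ hj₂ hj₃ h12 hle hmin hprime hp5 hpT hpd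
  exact one_le_padicValRat_of_eq hUU hU' hZ hU

end Assembly2

end Summit.KontsevichZagierPeriods.Zeta5Search.BigPrime

end
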